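import Literature.AlgebraicGeometry.HodgeTheory.WeilClassesSixfolds
import Literature.AlgebraicGeometry.HodgeTheory.WeilClassesFourfoldsStep2
import Literature.AlgebraicGeometry.HodgeTheory.AlgebraicClassesCupAbelianVariety
import Literature.AlgebraicGeometry.HodgeTheory.HypersurfaceLefschetzProofs
import Literature.AlgebraicGeometry.Motives.TateAbelianFiniteLatticeProofs
import Literature.AlgebraicGeometry.Motives.AbelianVarietyProjectiveChart
import Literature.AlgebraicTopology.SingularHomology.CohomologyOfPoint
import Literature.NumberTheory.DiophantineGeometry.AVIsogenyFlat
import Literature.AlgebraicGeometry.HodgeTheory.AbelianVarietyEndomorphismsHOne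
import Literature.AlgebraicGeometry.Motives.AbelianVarietyCohomologyExteriorH1
import HarnessLib

/-!
# Weil classes on hyperbolic abelian sixfolds (Markman 2025, Thm. 1.5.1): `η(K)` acts via algebraic correspondences, proved

Family `hodge`, layer `Literature/AlgebraicGeometry/HodgeTheory`. Second sibling proof file of
`WeilClassesSixfolds`, which states the named fact
`Markman2025_weilClasses_algebraic_hyperbolicSixfold` (E. Markman, *Cycles on abelian 2n-folds of
Weil type from secant sheaves on abelian n-folds*, arXiv:2502.03415, **Thm. 1.5.1**, verbatim:
"Let `d` be a positive integer. Set `K := ℚ(√-d)`. The Hodge-Weil classes of polarized abelian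
sixfolds of Weil type with complex multiplication by `K` and with discriminant `-1` are
algebraic."). That fact is NOT discharged here and this file introduces NO named fact
(fact-decomposition discipline). The first sibling, `WeilClassesSixfoldsSplitProofs`, records the
last inference of the printed proof as the reduction `…_of_translates_span` with TWO hypotheses:
(corr) "the pull-backs `(x·𝟙 + y·φ)^*` preserve `algebraicClasses A.X 3`" — there "not available
for these endomorphisms on the carriers, hence a hypothesis" — and (κ + span). **This file PROVES
(corr)** on the real carriers, for every complex abelian variety, every degree and every
`(x, y) ∈ ℕ²`, and so reduces the fact to (κ + span) alone; it then records the linear algebra by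
which a spanning statement of the shape of Thm. 1.4.1 is used (eigencomponents of algebraic
classes are algebraic), and discharges hypothesis (V) of the first sibling's
`….fourfold_of_hyperbolic_partner` by the tree's `AbelianVariety.cupProduct_mem_algebraicClasses_one`.

## The printed inference (held copy of arXiv:2502.03415, text read; "Proof of Theorem 1.5.1",
end of the subsection "A semiregular reflexive secant^{⊠2}-sheaf", chunk 74 of 110, verbatim)

"The algebraicity of the Hodge-Weil classes follows from that of `κ₃(ℬ)` and Theorem 1.4.1
([item: "The `η(K)`-translates of the graded summand `κ₃(ℰ)` of `κ(ℰ)` in `H^{3,3}(X × X̂, ℚ)`,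
together with `h³`, span the `3`-dimensional subspace `ℚ h³ ⊕ HW_P`"]), since given a polarized
abelian variety of Weil type `(A, η, h)` the rational endomorphisms `η(K) ⊂ End_ℚ(A)` act on
`H^*(A, ℚ)` via algebraic correspondences." On the carriers the action of `End(A)` on
`Hᵏ(A(ℂ); ℂ)` is the pull-back `f^*` (van Geemen, LNM 1594, 4.8: "using the maps `f^*` … the
algebra `End(X)_ℚ` acts"), the Weil plane is cut out by the pull-backs `(x·𝟙 + y·φ)^*`, `x y : ℕ`
(`WeilClasses`), and `algebraicClasses A.X p = Nᵖ H²ᵖ(A(ℂ); ℂ)` (`AlgebraicClasses`).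

## What is proved here (everything below is a theorem; no `sorry`, no new `def`)

* § Non-zero elements of `ℤ[φ]` are isogenies: `zsmul_id_add_zsmul_comp_zsmul_id_sub_zsmul` (the
  norm identity `(x·𝟙 + y·φ) ≫ (x·𝟙 - y·φ) = (x² + dy²)·𝟙` in `End(A)` for `φ ≫ φ = -d`),
  `isIsogeny_zsmul_id_add_zsmul` (**`x·𝟙 + y·φ` is an isogeny for `(x, y) ≠ (0, 0)`**: it divides
  the isogeny `[x² + dy²]` on both sides — the tree's `isIsogeny_zsmul_id_of_cast_ne_zero`,
  Görtz–Wedhorn II Prop. 27.186–27.187, and `isIsogeny_of_comp_eq_of_comp_eq`),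
  `isIsogeny_nsmul_id_add_nsmul`, `isIsogeny_of_comp_self_eq_neg_nsmul` (`φ` itself).
* § Isogenies act by algebraic correspondences: `map_mem_algebraicClasses_of_isIsogeny`
  (**`f^*(Nᵖ H²ᵖ(B)) ⊆ Nᵖ H²ᵖ(A)` for an isogeny `f : A ⟶ B`**: isogenies are flat — the tree's
  `IsIsogeny.flat`, Milne §8 Prop. 8.1 (d) — abelian varieties are smooth projective
  (`AbelianVariety.isSmoothProjective_holds`), and flat pull-back preserves `Nᵖ`,
  `map_mem_algebraicClasses_of_flat`, Grothendieck 1969 §1); the zero endomorphism too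
  (`complexBetti_map_zero_hom_apply`: `0^* = 0` in positive degrees, as `0` factors through the
  point `Spec ℂ`, whose positive-degree cohomology vanishes, Hatcher §3.1; `map_zero_hom_mem_algebraicClasses`);
  hence `map_nsmul_id_add_nsmul_mem_algebraicClasses`: **for `φ ≫ φ = -d`, `d ≥ 1`, every
  `(x·𝟙 + y·φ)^*`, `x y : ℕ`, preserves `algebraicClasses A.X p`** — hypothesis (corr) of
  `WeilClassesSixfoldsSplitProofs.…_of_translates_span`, unconditionally — and the `ℤ`-version
  `map_zsmul_id_add_zsmul_mem_algebraicClasses` for `(x, y) ≠ (0, 0)`.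
* § The fact from (κ + span) alone: `Markman2025_weilClasses_algebraic_hyperbolicSixfold_of_kappa_span`
  (= `…_of_translates_span` with (corr) discharged): the single residual obligation of the printed
  proof on these carriers is now "on every hyperbolic `(A, φ, h)` there is a set `T` of ALGEBRAIC
  classes in `H⁶` (print: `κ₃` of the deformed semiregular secant sheaf, and `h³`) whose
  `ℕ[φ]`-translates span the rational `(3,3)` Weil classes (Thm. 1.4.1)". Pointwise forms for one
  `(A, φ, d)`: `weilClassesOf_le_algebraicClasses_of_le_span_translates` (any `n`, `ℤ[φ]`-translates
  of one algebraic `κ` and a set `G` of algebraic classes) and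
  `Markman2025_weilClasses_algebraic_hyperbolicSixfold.pointwise_of_le_span_translates` (`n = 3`).
* § `h` and `h³` are algebraic — PROVED for the fact's symmetrised hyperplane class
  `h = d·ι^*a + φ^*ι^*a`: `symmetrisedHyperplaneClass_mem_algebraicClasses` (`ι^*a ∈ N¹ H²` by the
  tree's `map_projectiveSpace_mem_algebraicClasses`, Voisin II Cor. 1.24; `φ^*ι^*a` by the isogeny
  `φ`), `cupProduct_cupProduct_mem_algebraicClasses_three` (`(h ∪ h) ∪ h ∈ N³ H⁶` on an abelian
  variety, by `AbelianVariety.cupProduct_mem_algebraicClasses_one` twice); hence the sharper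
  reduction `Markman2025_weilClasses_algebraic_hyperbolicSixfold_of_kappa₃_translates_span`: **the
  fact follows from the single hypothesis "(κ₃ + span): on every hyperbolic `(A, φ, h)` some ONE
  algebraic class `κ ∈ H⁶` has its `ℕ[φ]`-translates spanning, together with `h³`, the rational
  `(3,3)` Weil classes"** — Thm. 1.4.1 with "`κ₃(ℬ)` is algebraic" — everything else in the last
  inference of the printed proof being proved here.
* § The linear algebra of "translates span": `mem_of_sum_eigenvectors_mem` (pure linear algebra:
  joint eigencomponents, for pairwise separated characters, of a vector lying in a subspace stable
  under the operators lie in that subspace — induction on the number of components, twisting by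
  `T_p - χⱼ(p)`), `mem_algebraicClasses_of_sum_mem_pullbackEigenclasses` (with
  `S = algebraicClasses`, stable by the previous §), `exists_ne_weilCharacter` (the two Weil
  characters differ at some test isogeny `x·𝟙 + φ`), hence **the `E₊`- and `E₋`-components of an
  algebraic class of the Weil plane are algebraic** (`mem_algebraicClasses_of_add_mem_weilClasses`,
  unconditional) and the Weil plane is algebraic as soon as `E₊`, `E₋` are the lines through the
  two components of ONE algebraic class (`weilClassesOf_le_algebraicClasses_of_components`,
  `….pointwise_of_components`, and the global reduction `…_of_components`; in print
  `E± = ⋀⁶ W, ⋀⁶ W̄` are lines — van Geemen, proof of Thm. 6.12 — and the class is `κ₃(ℰ)`).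
* § (V) discharged: `Markman2025_weilClasses_algebraic_hyperbolicSixfold.fourfold_of_hyperbolic_partner'`
  — the first sibling's assembly of Cor. 1.6.1 (proof) / arXiv:2509.23403 §11.5 Step 2 without its
  hypothesis (V) "cup products of algebraic classes of codimensions `3` and `1` on the product
  sixfold are algebraic", which is the tree's `AbelianVariety.cupProduct_mem_algebraicClasses_one`
  (Kleiman moving by translations) on the abelian variety `A₁ × A₂`.

* § (v4) **Granted `H•(A(ℂ); ℂ) = ⋀• H¹(A(ℂ); ℂ)`, ONE non-zero algebraic Weil class suffices.**
  With the Weil LINES of `AbelianVarietyEndomorphismsHOne` (`dim E± = 1` granted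
  `HasExteriorCohomologyH1 ℂ A(ℂ)` and `b₁ = 4n`, i.e. the instance of the named fact
  `Motives.abelianVarietyCohomologyExteriorH1`; a non-zero class of `E±` spans it) and complex
  conjugation (swaps `E₊`, `E₋`, preserves algebraic classes — unconditional):
  `weilClassesOf_le_algebraicClasses_of_exists_ne_zero` (a non-zero algebraic class `c = c₊ + c₋`
  of the Weil plane has algebraic components, one of them non-zero, its line algebraic, and the
  conjugate line too), `exists_ne_zero_of_weilClassesOf_le_algebraicClasses` and
  `weilClassesOf_le_algebraicClasses_iff_exists_ne_zero` (the plane has dimension `2`),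
  `Markman2025_weilClasses_algebraic_hyperbolicSixfold.pointwise_of_exists_ne_zero`, and the global
  reduction **`Markman2025_weilClasses_algebraic_hyperbolicSixfold_of_exists_algebraic_weilClass`:
  granted the `⋀`-structure of `H•(A(ℂ))` for abelian sixfolds, Thm. 1.5.1 on the carriers follows
  from "every hyperbolic Weil-type `(A, φ, h)` of dimension `6` carries ONE non-zero algebraic
  class in `W_K ⊗ ℂ`"** — in print the projection of `κ₃(ℰ)` to the Weil plane, non-zero by
  Thm. 1.4.1 (4) and algebraic by Thm. 1.4.1 (3) with §6–§9; this residual is the paper proper.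

* § (v5) **The same, consuming the named fact `Motives.abelianVarietyCohomologyExteriorH1` BY NAME.**
  The per-`A` hypotheses of § (v4) are the instance `dim A = 2n` of that named fact
  (`hasExteriorCohomologyH1_and_finrank_one_of_dim_eq`); taking it as the explicit hypothesis
  `(h : Motives.abelianVarietyCohomologyExteriorH1)` (a CONDITIONAL use; nothing here discharges it)
  gives `finrank_weilClassesOf_eq_two_of_dim_eq` (the Weil plane of a Weil-type `2n`-fold is a
  plane), `weilClassesOf_le_algebraicClasses_iff_exists_ne_zero_of_dim_eq`, and
  **`Markman2025_weilClasses_algebraic_hyperbolicSixfold_of_abelianVarietyCohomologyExteriorH1`**: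
  `Motives.abelianVarietyCohomologyExteriorH1 →` ("one non-zero algebraic Weil class on every
  hyperbolic Weil-type sixfold") `→ Markman2025_weilClasses_algebraic_hyperbolicSixfold` — the forms to
  be fed `Motives.abelianVarietyCohomologyExteriorH1_holds` once that fact is proved.

## What is NOT here (no carrier in the tree; see the module docstrings of `WeilClasses`,
`WeilClassesSixfolds`, `WeilClassesSixfoldsSplitProofs`)

The inputs of (κ₃ + span): the secant sheaf `ℰ` on `X × X̂` (Orlov's equivalence, `Spin(V)`
representation theory, Lemma "the discriminant is `(-1)ⁿ`"), its characteristic class in Betti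
cohomology and the algebraicity of `κ₃(ℬ)` over an open subset of the `9`-dimensional moduli space
(twisted Buchweitz–Flenner semiregularity theorem), the spanning statement of Thm. 1.4.1 itself and
`dim E± = 1` (needs `H^*(A(ℂ)) = ⋀^* H¹`), the algebraicity-locus / moduli-component argument
(cf. `AlgebraicityLocus`), and the isogeny transport between components (`WeilClassesIsogenyDescent`
proves the transport; the classification of components by `(n, K, det H)` is not on the carriers).

## References

* [Markman2025SecantWeil] E. Markman, Cycles on abelian 2n-folds of Weil type from secant sheaves
  on abelian n-folds, arXiv:2502.03415: §1.1, Thm. 1.4.1 (the item on `η(K)`-translates of `κ₃(ℰ)`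
  and `h³`), §1.5, Thm. 1.5.1 and its proof ("Proof of Theorem 1.5.1", end of the subsection
  "A semiregular reflexive secant^{⊠2}-sheaf"), Cor. 1.6.1 and its proof (text read, held copy).
* [Markman2025SurveySecant] E. Markman, Secant sheaves and Weil classes on abelian varieties,
  arXiv:2509.23403: Thm. 1.2, §11.5 Steps 1–2 (text read, held copy).
* [Milne1986AbelianVarieties] J. S. Milne, Abelian varieties (Cornell–Silverman 1986), §8
  Prop. 8.1 (isogeny ⇔ finite flat surjective) and the paragraph following it (`n_A = g ∘ f`).
* [GortzWedhorn2023] U. Görtz, T. Wedhorn, Algebraic Geometry II, Prop. 27.54, Prop. 27.186–27.187.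
* [vanGeemen1994HodgeAV] B. van Geemen, LNM 1594 (1994), 4.8–4.9 (the action of `End(X)_ℚ` by
  `f^*`), proof of Thm. 6.12.
* [GrothendieckTopology1969] A. Grothendieck, Topology 8 (1969), §1 (flat pull-back of `Nᵖ`).
* [HatcherAT2002] A. Hatcher, Algebraic Topology, §3.1 p. 199 (`Hⁿ(pt) = 0`, `n > 0`).
* [VoisinHodgeII2003] C. Voisin, Hodge Theory and Complex Algebraic Geometry II, §1.2.3 Cor. 1.24,
  §9.2.4 Prop. 9.20.
* [Schoen1998HodgeWeilAddendum] C. Schoen, Compositio Math. 114 (1998), §10.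
-/

noncomputable section

open CategoryTheory AlgebraicGeometry MonoidalCategory

namespace Literature.AlgebraicGeometry.HodgeTheory

open Literature.AlgebraicTopology.SingularHomology
open Literature.AlgebraicGeometry.Motives.AbelianVariety

section HodgeTheory

variable {A B : Motives.AbelianVariety ℂ}

/-! ### Non-zero elements of `ℤ[φ]` are isogenies -/

/-- **The norm identity in `End(A)`**: for `φ ≫ φ = -d` and integers `x, y`,
`(x·𝟙 + y·φ) ≫ (x·𝟙 - y·φ) = (x² + d y²)·𝟙` (`Nm_{K/ℚ}(x + y√-d) = x² + dy²`; composition is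
bilinear, `Preadditive (AbelianVariety ℂ)`). [folklore] -/
theorem zsmul_id_add_zsmul_comp_zsmul_id_sub_zsmul {d : ℕ} {φ : A ⟶ A}
    (hφ : φ ≫ φ = -(d • 𝟙 A)) (x y : ℤ) :
    (x • 𝟙 A + y • φ) ≫ (x • 𝟙 A - y • φ) = (x ^ 2 + (d : ℤ) * y ^ 2) • 𝟙 A := by
  have hφ' : φ ≫ φ = -((d : ℤ) • 𝟙 A) := by rw [natCast_zsmul]; exact hφ
  simp only [Preadditive.add_comp, Preadditive.comp_sub, Preadditive.zsmul_comp,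
    Preadditive.comp_zsmul, Category.id_comp, Category.comp_id, hφ']
  module

/-- The norm identity in the other order: `(x·𝟙 - y·φ) ≫ (x·𝟙 + y·φ) = (x² + d y²)·𝟙`
(`ℤ[φ]` is commutative). [folklore] -/
theorem zsmul_id_sub_zsmul_comp_zsmul_id_add_zsmul {d : ℕ} {φ : A ⟶ A}
    (hφ : φ ≫ φ = -(d • 𝟙 A)) (x y : ℤ) :
    (x • 𝟙 A - y • φ) ≫ (x • 𝟙 A + y • φ) = (x ^ 2 + (d : ℤ) * y ^ 2) • 𝟙 A := by
  have hφ' : φ ≫ φ = -((d : ℤ) • 𝟙 A) := by rw [natCast_zsmul]; exact hφ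
  simp only [Preadditive.sub_comp, Preadditive.comp_add, Preadditive.zsmul_comp,
    Preadditive.comp_zsmul, Category.id_comp, Category.comp_id, hφ']
  module

/-- `x² + d y² ≠ 0` for `d ≥ 1` and `(x, y) ≠ (0, 0)` (the norm form of `ℚ(√-d)` is anisotropic).
[folklore] -/
theorem sq_add_natCast_mul_sq_ne_zero {d : ℕ} (hd : 0 < d) {x y : ℤ} (hxy : (x, y) ≠ (0, 0)) :
    x ^ 2 + (d : ℤ) * y ^ 2 ≠ 0 := by
  have hd' : (0 : ℤ) < d := by exact_mod_cast hd
  rcases ne_or_eq x 0 with hx | rfl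
  · have h1 : 0 < x ^ 2 := by positivity
    have h2 : 0 ≤ (d : ℤ) * y ^ 2 := by positivity
    exact (add_pos_of_pos_of_nonneg h1 h2).ne'
  · have hy : y ≠ 0 := by rintro rfl; exact hxy rfl
    have h1 : 0 < y ^ 2 := by positivity
    rw [zero_pow two_ne_zero, zero_add]
    exact (mul_pos hd' h1).ne'

/-- **Non-zero elements of `ℤ[φ]` are isogenies.** For `φ ≫ φ = -d`, `d ≥ 1`, and integers
`(x, y) ≠ (0, 0)`, the endomorphism `x·𝟙 + y·φ` is an isogeny (surjective and finite): it is a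
two-sided factor of multiplication by `N = x² + dy² ≠ 0` (the norm identities), `[N]` is an
isogeny in characteristic `0` (the tree's `isIsogeny_zsmul_id_of_cast_ne_zero`, Görtz–Wedhorn II
Prop. 27.186–27.187), and a morphism `f` with `h ≫ f` surjective and `f ≫ h` finite is surjective
and finite (the tree's `isIsogeny_of_comp_eq_of_comp_eq`). (Milne §8: an isogeny of degree `m`
divides `[m]`; here conversely the divisors `x + y√-d` of `[Nm(x + y√-d)]` in `ℤ[√-d] ⊆ End(A)`
are isogenies.) [cite: GortzWedhorn2023, Prop. 27.187] [cite: Milne1986AbelianVarieties, §8 (Prop. 8.1 and the paragraph following it)] -/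
theorem isIsogeny_zsmul_id_add_zsmul {d : ℕ} (hd : 0 < d) {φ : A ⟶ A}
    (hφ : φ ≫ φ = -(d • 𝟙 A)) {x y : ℤ} (hxy : (x, y) ≠ (0, 0)) :
    IsIsogeny (x • 𝟙 A + y • φ) := by
  have hN := sq_add_natCast_mul_sq_ne_zero hd hxy
  have hiso : IsIsogeny ((x ^ 2 + (d : ℤ) * y ^ 2) • 𝟙 A) :=
    isIsogeny_zsmul_id_of_cast_ne_zero _ (Int.cast_ne_zero.mpr hN)
  exact isIsogeny_of_comp_eq_of_comp_eq hiso hiso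
    (zsmul_id_sub_zsmul_comp_zsmul_id_add_zsmul hφ x y)
    (zsmul_id_add_zsmul_comp_zsmul_id_sub_zsmul hφ x y)

/-- The same for natural-number coefficients (the test endomorphisms `x·𝟙 + y·φ`, `x y : ℕ`, by
which `WeilClasses` cuts out the Weil plane): `x·𝟙 + y·φ` is an isogeny for `(x, y) ≠ (0, 0)`.
[cite: GortzWedhorn2023, Prop. 27.187] -/
theorem isIsogeny_nsmul_id_add_nsmul {d : ℕ} (hd : 0 < d) {φ : A ⟶ A}
    (hφ : φ ≫ φ = -(d • 𝟙 A)) {x y : ℕ} (hxy : (x, y) ≠ (0, 0)) :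
    IsIsogeny (x • 𝟙 A + y • φ) := by
  have h := isIsogeny_zsmul_id_add_zsmul hd hφ (x := x) (y := y)
    (by simpa [Prod.ext_iff] using hxy)
  simpa only [natCast_zsmul] using h

/-- In particular **`φ` is an isogeny** (`φ ≫ φ = -d ≠ 0`; `√-d` has norm `d`).
[cite: GortzWedhorn2023, Prop. 27.187] -/
theorem isIsogeny_of_comp_self_eq_neg_nsmul {d : ℕ} (hd : 0 < d) {φ : A ⟶ A}
    (hφ : φ ≫ φ = -(d • 𝟙 A)) : IsIsogeny φ := by
  have h := isIsogeny_zsmul_id_add_zsmul hd hφ (x := 0) (y := 1) (by simp)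
  simpa using h

/-! ### Isogenies (and the zero homomorphism) act by algebraic correspondences -/

/-- **Isogenies act on cohomology by algebraic correspondences**: the pull-back `f^*` along an
isogeny `f : A ⟶ B` of complex abelian varieties maps `algebraicClasses B.X p = Nᵖ H²ᵖ(B(ℂ); ℂ)`
into `algebraicClasses A.X p` — isogenies are flat (Milne §8 Prop. 8.1 (d); the tree's
`IsIsogeny.flat`), abelian varieties are smooth projective hence locally Noetherian
(`AbelianVariety.isSmoothProjective_holds`), and flat pull-back preserves classes supported in
codimension `≥ p` (`map_mem_algebraicClasses_of_flat`, Grothendieck 1969 §1: `f⁻¹Z` has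
codimension `≥ p`). [cite: Milne1986AbelianVarieties, §8 Prop. 8.1] [cite: GrothendieckTopology1969, §1] -/
theorem map_mem_algebraicClasses_of_isIsogeny {f : A ⟶ B} (hf : IsIsogeny f) {p : ℕ}
    {x : complexBetti B.X (2 * p)} (hx : x ∈ algebraicClasses B.X p) :
    complexBetti.map f.hom.hom.hom (2 * p) x ∈ algebraicClasses A.X p := by
  haveI : IsLocallyNoetherian A.X.left :=
    Motives.IsSmoothProjective.isLocallyNoetherian_holds (isSmoothProjective_holds (A := A))
  haveI : IsLocallyNoetherian B.X.left :=
    Motives.IsSmoothProjective.isLocallyNoetherian_holds (isSmoothProjective_holds (A := B))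
  haveI : Flat f.hom.hom.hom.left := hf.flat
  exact map_mem_algebraicClasses_of_flat f.hom.hom.hom hx

/-- **The zero homomorphism kills positive-degree cohomology**: `0^* z = 0` for
`z ∈ Hⁱ(B(ℂ); ℂ)`, `i ≠ 0`, because `0 : A ⟶ B` is the composite `A → Spec ℂ → B` of the
structure map and the unit (definitionally, `hom_zero`), and `Hⁱ(pt; ℂ) = 0` for `i > 0` (the
tree's `isZero_singularCohomology_of_subsingleton'`; the complex points of `Spec ℂ` form a
subsingleton). [cite: HatcherAT2002, §3.1 p. 199] -/
theorem complexBetti_map_zero_hom_apply {i : ℕ} (hi : i ≠ 0) (z : complexBetti B.X i) :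
    complexBetti.map (0 : A ⟶ B).hom.hom.hom i z = 0 := by
  have h0 : (0 : A ⟶ B).hom.hom.hom =
      CartesianMonoidalCategory.toUnit A.X ≫ (MonObj.one : 𝟙_ (Motives.SchemeOver ℂ) ⟶ B.X) :=
    rfl
  have hZ : Limits.IsZero (complexBetti (𝟙_ (Motives.SchemeOver ℂ)) i) :=
    singularCochainComplex.isZero_singularCohomology_of_subsingleton' (R := ℂ) (M := ℂ) hi
  haveI := ModuleCat.subsingleton_of_isZero hZ
  have hz : complexBetti.map (MonObj.one : 𝟙_ (Motives.SchemeOver ℂ) ⟶ B.X) i z = 0 :=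
    Subsingleton.elim _ _
  rw [h0, complexBetti.map_comp, ModuleCat.comp_apply, hz, map_zero]

/-- Hence the pull-back along the zero homomorphism preserves algebraic classes in every degree
(`0^* z = 0` for `p > 0`; in codimension `0` every class is algebraic, `algebraicClasses_zero`).
[folklore] -/
theorem map_zero_hom_mem_algebraicClasses {p : ℕ} (z : complexBetti B.X (2 * p)) :
    complexBetti.map (0 : A ⟶ B).hom.hom.hom (2 * p) z ∈ algebraicClasses A.X p := by
  rcases Nat.eq_zero_or_pos p with rfl | hp
  · rw [algebraicClasses_zero]; trivial
  · rw [complexBetti_map_zero_hom_apply (by omega) z]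
    exact Submodule.zero_mem _

/-- **The `ℤ[φ]`-translates of an algebraic class are algebraic**: for `φ ≫ φ = -d`, `d ≥ 1`,
integers `(x, y) ≠ (0, 0)` and `κ ∈ algebraicClasses A.X p`, the translate `(x·𝟙 + y·φ)^* κ` is
algebraic ("`η(K)` … act on `H^*(A, ℚ)` via algebraic correspondences").
[cite: Markman2025SecantWeil, Thm. 1.5.1 (proof)] [cite: vanGeemen1994HodgeAV, 4.8] -/
theorem map_zsmul_id_add_zsmul_mem_algebraicClasses {d : ℕ} (hd : 0 < d) {φ : A ⟶ A}
    (hφ : φ ≫ φ = -(d • 𝟙 A)) {x y : ℤ} (hxy : (x, y) ≠ (0, 0)) {p : ℕ}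
    {κ : complexBetti A.X (2 * p)} (hκ : κ ∈ algebraicClasses A.X p) :
    complexBetti.map (x • 𝟙 A + y • φ).hom.hom.hom (2 * p) κ ∈ algebraicClasses A.X p :=
  map_mem_algebraicClasses_of_isIsogeny (isIsogeny_zsmul_id_add_zsmul hd hφ hxy) hκ

/-- **Hypothesis (corr) of `WeilClassesSixfoldsSplitProofs.…_of_translates_span`, proved**: for
`φ ≫ φ = -d`, `d ≥ 1`, EVERY test endomorphism `x·𝟙 + y·φ` (`x y : ℕ`) pulls algebraic classes
back to algebraic classes, in every degree — an isogeny for `(x, y) ≠ (0, 0)`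
(`map_mem_algebraicClasses_of_isIsogeny`), the zero homomorphism for `(x, y) = (0, 0)`
(`map_zero_hom_mem_algebraicClasses`). [cite: Markman2025SecantWeil, Thm. 1.5.1 (proof)] [cite: vanGeemen1994HodgeAV, 4.8] -/
theorem map_nsmul_id_add_nsmul_mem_algebraicClasses {d : ℕ} (hd : 0 < d) {φ : A ⟶ A}
    (hφ : φ ≫ φ = -(d • 𝟙 A)) (x y : ℕ) {p : ℕ}
    {κ : complexBetti A.X (2 * p)} (hκ : κ ∈ algebraicClasses A.X p) :
    complexBetti.map (x • 𝟙 A + y • φ).hom.hom.hom (2 * p) κ ∈ algebraicClasses A.X p := by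
  by_cases hxy : (x, y) = (0, 0)
  · obtain ⟨rfl, rfl⟩ := Prod.mk.inj hxy
    have h0 : ((0 : ℕ) • 𝟙 A + (0 : ℕ) • φ : A ⟶ A) = 0 := by simp
    rw [h0]
    exact map_zero_hom_mem_algebraicClasses κ
  · exact map_mem_algebraicClasses_of_isIsogeny (isIsogeny_nsmul_id_add_nsmul hd hφ hxy) hκ

/-! ### The fact from (κ + span) alone -/

/-- **Markman's last inference as a proved reduction, with (corr) discharged.** The reduction
`Markman2025_weilClasses_algebraic_hyperbolicSixfold_of_translates_span` of
`WeilClassesSixfoldsSplitProofs` with its first hypothesis (corr) supplied by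
`map_nsmul_id_add_nsmul_mem_algebraicClasses`: IF (κ + span) on every hyperbolic `(A, φ, h)` as in
the fact there is a set `T ⊆ H⁶(A(ℂ); ℂ)` of ALGEBRAIC classes (print: `κ₃` of the deformed
semiregular secant sheaf, algebraic where the twisted semiregularity theorem deforms it, and `h³`)
such that every rational `(3,3)`-class of the Weil plane lies in the `ℂ`-span of `T` and of its
translates `(x·𝟙 + y·φ)^* t` (Thm. 1.4.1: "The `η(K)`-translates of … `κ₃(ℰ)` …, together with
`h³`, span … `ℚ h³ ⊕ HW_P`"), THEN the fact. (κ + span) is now the single residual obligation of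
the printed proof on these carriers; it is a hypothesis of a theorem, not a named fact.
[cite: Markman2025SecantWeil, Thm. 1.4.1 and Thm. 1.5.1 (proof)] -/
theorem Markman2025_weilClasses_algebraic_hyperbolicSixfold_of_kappa_span
    (hκ : ∀ (d : ℕ), 0 < d → ∀ (A : Motives.AbelianVariety ℂ) (φ : A ⟶ A), A.dim = 2 * 3 →
      Motives.IsSmoothProjective (2 * 3) A.X → φ ≫ φ = -(d • 𝟙 A) →
        ∀ (e : Motives.ProjectiveEmbedding A.X) (a : complexBetti (Motives.projectiveSpace e.n ℂ) 2),
          IsRationalClass a → a ≠ 0 →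
            Motives.IsHyperbolicWeilType A φ 3
              ((d : ℂ) • complexBetti.map e.ι 2 a +
                complexBetti.map φ.hom.hom.hom 2 (complexBetti.map e.ι 2 a)) →
              ∃ T : Set (complexBetti A.X (2 * 3)), T ⊆ algebraicClasses A.X 3 ∧
                ∀ c : complexBetti A.X (2 * 3), IsRationalClass c →
                  IsOfHodgeType (2 * 3) A.X (2 * 3) 3 3 c → c ∈ weilClassesOf A φ 3 d →
                    c ∈ Submodule.span ℂ (T ∪ ⋃ ψ ∈ {ψ : A ⟶ A | ∃ x y : ℕ, ψ = x • 𝟙 A + y • φ},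
                      complexBetti.map ψ.hom.hom.hom (2 * 3) '' T)) :
    Markman2025_weilClasses_algebraic_hyperbolicSixfold := by
  intro d hd A φ hA hX hφ e a ha ha0 hhyp c hc h33 hW
  obtain ⟨T, hT, hspan⟩ := hκ d hd A φ hA hX hφ e a ha ha0 hhyp
  refine (Submodule.span_le.mpr ?_) (hspan c hc h33 hW)
  rintro w (hw | hw)
  · exact hT hw
  · simp only [Set.mem_iUnion, Set.mem_image] at hw
    obtain ⟨ψ, hψ, t, ht, rfl⟩ := hw
    obtain ⟨x, y, rfl⟩ := hψ
    exact map_nsmul_id_add_nsmul_mem_algebraicClasses hd hφ x y (hT ht)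

/-- **Step (iii) for one `(A, φ, d)`, any `n` (pointwise form).** Let `φ ≫ φ = -d`, `d ≥ 1`, let
`κ ∈ H²ⁿ(A(ℂ); ℂ)` be an algebraic class and `G` a set of algebraic classes. If the Weil plane
`weilClassesOf A φ n d` lies in the `ℂ`-span of the non-zero `ℤ[φ]`-translates `(x·𝟙 + y·φ)^* κ`
and of `G` — in print: `κ = κ₃(ℰ) = q^*κ₃(ℬ)`, `G = {h³}` — then every class of the Weil plane is
algebraic, because every translate is (`map_zsmul_id_add_zsmul_mem_algebraicClasses`) and
`algebraicClasses` is a subspace. [cite: Markman2025SecantWeil, Thm. 1.4.1 and Thm. 1.5.1 (proof)] -/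
theorem weilClassesOf_le_algebraicClasses_of_le_span_translates {n d : ℕ} (hd : 0 < d) {φ : A ⟶ A}
    (hφ : φ ≫ φ = -(d • 𝟙 A)) {κ : complexBetti A.X (2 * n)} (hκ : κ ∈ algebraicClasses A.X n)
    {G : Set (complexBetti A.X (2 * n))} (hG : G ⊆ algebraicClasses A.X n)
    (hspan : weilClassesOf A φ n d ≤ Submodule.span ℂ
      ({c | ∃ x y : ℤ, (x, y) ≠ (0, 0) ∧
          c = complexBetti.map (x • 𝟙 A + y • φ).hom.hom.hom (2 * n) κ} ∪ G)) :
    weilClassesOf A φ n d ≤ algebraicClasses A.X n := by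
  refine hspan.trans (Submodule.span_le.mpr (Set.union_subset ?_ hG))
  rintro _ ⟨x, y, hxy, rfl⟩
  exact map_zsmul_id_add_zsmul_mem_algebraicClasses hd hφ hxy hκ

/-- **The fact's conclusion for one `(A, φ, d)`, `n = 3`, from step (iii)**: if on the complex
abelian sixfold `(A, φ)`, `φ ≫ φ = -d`, some algebraic class `κ ∈ H⁶(A(ℂ); ℂ)` (`κ₃(ℰ)`) and an
algebraic class `h₃` (`h³`) have the spanning property of Thm. 1.4.1 — the Weil plane lies in the
span of the non-zero `ℤ[φ]`-translates of `κ` and `h₃` — then every rational `(3,3)`-class of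
`weilClassesOf A φ 3 d` is algebraic: the conclusion of
`Markman2025_weilClasses_algebraic_hyperbolicSixfold` for `(A, φ, d)` (for every embedding and
hyperplane class). [cite: Markman2025SecantWeil, Thm. 1.5.1 (proof)] -/
theorem Markman2025_weilClasses_algebraic_hyperbolicSixfold.pointwise_of_le_span_translates {d : ℕ}
    (hd : 0 < d) {φ : A ⟶ A} (hφ : φ ≫ φ = -(d • 𝟙 A))
    {κ : complexBetti A.X (2 * 3)} (hκ : κ ∈ algebraicClasses A.X 3)
    {h₃ : complexBetti A.X (2 * 3)} (hh₃ : h₃ ∈ algebraicClasses A.X 3)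
    (hspan : weilClassesOf A φ 3 d ≤ Submodule.span ℂ
      ({c | ∃ x y : ℤ, (x, y) ≠ (0, 0) ∧
          c = complexBetti.map (x • 𝟙 A + y • φ).hom.hom.hom (2 * 3) κ} ∪ {h₃})) :
    ∀ c : complexBetti A.X (2 * 3), IsRationalClass c →
      IsOfHodgeType (2 * 3) A.X (2 * 3) 3 3 c → c ∈ weilClassesOf A φ 3 d →
        c ∈ algebraicClasses A.X 3 :=
  fun _ _ _ hcW ↦ weilClassesOf_le_algebraicClasses_of_le_span_translates hd hφ hκ
    (Set.singleton_subset_iff.mpr hh₃) hspan hcW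

/-! ### The symmetrised hyperplane class `h` of the fact and `h³` are algebraic

In the fact, the polarization enters through `h = d·ι^*a + φ^*ι^*a` for a projective embedding
`ι : A ⟶ ℙᴺ` and a rational `a ∈ H²(ℙᴺ(ℂ); ℂ)`. Every `ι^*a` is algebraic on the smooth
projective `A` (the tree's `map_projectiveSpace_mem_algebraicClasses`: `a` dies off a general
linear subspace of codimension `1`, Voisin II Cor. 1.24), `φ^*ι^*a` is algebraic because `φ` is
an isogeny, and on an abelian variety cup products with classes of `N¹ H²` raise the coniveau
(`AbelianVariety.cupProduct_mem_algebraicClasses_one`, Kleiman moving by translations): so `h³`,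
the second generator of Markman's `ℚ h³ ⊕ HW_P`, is algebraic with no hypothesis. -/

/-- **The symmetrised hyperplane class of the fact is algebraic**: for `φ ≫ φ = -d`, `d ≥ 1`, a
projective embedding `e` of `A` and any `a ∈ H²(ℙᴺ(ℂ); ℂ)`, `h = d·ι^*a + φ^*ι^*a ∈ N¹ H²(A(ℂ); ℂ)`
(`ι^*a` by `map_projectiveSpace_mem_algebraicClasses`, abelian varieties being smooth projective;
`φ^*ι^*a` by `map_mem_algebraicClasses_of_isIsogeny`). [cite: VoisinHodgeII2003, §1.2.3 Cor. 1.24]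
[cite: Markman2025SecantWeil, §1.1] -/
theorem symmetrisedHyperplaneClass_mem_algebraicClasses {d : ℕ} (hd : 0 < d) {φ : A ⟶ A}
    (hφ : φ ≫ φ = -(d • 𝟙 A)) (e : Motives.ProjectiveEmbedding A.X)
    (a : complexBetti (Motives.projectiveSpace e.n ℂ) 2) :
    ((d : ℂ) • complexBetti.map e.ι 2 a +
        complexBetti.map φ.hom.hom.hom 2 (complexBetti.map e.ι 2 a)) ∈ algebraicClasses A.X 1 := by
  have ha : complexBetti.map e.ι 2 a ∈ algebraicClasses A.X 1 :=
    map_projectiveSpace_mem_algebraicClasses (isSmoothProjective_holds (A := A)) e.ι 1 a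
  exact Submodule.add_mem _ (Submodule.smul_mem _ _ ha)
    (map_mem_algebraicClasses_of_isIsogeny (isIsogeny_of_comp_self_eq_neg_nsmul hd hφ) ha)

/-- **`h³ ∈ N³ H⁶` for `h ∈ N¹ H²` on a complex abelian variety**: `(h ∪ h) ∪ h` is algebraic, by
two applications of `AbelianVariety.cupProduct_mem_algebraicClasses_one` (Voisin II Prop. 9.20 for
(cycle) × (divisor) on abelian varieties, proved in the tree by moving with a general translate).
[cite: VoisinHodgeII2003, §9.2.4 Prop. 9.20] -/
theorem cupProduct_cupProduct_mem_algebraicClasses_three {h : complexBetti A.X 2}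
    (hh : h ∈ algebraicClasses A.X 1) :
    cupProduct (two_mul_add_two_mul 2 1) (cupProduct (two_mul_add_two_mul 1 1) h h) h ∈
      algebraicClasses A.X 3 :=
  AbelianVariety.cupProduct_mem_algebraicClasses_one A
    (AbelianVariety.cupProduct_mem_algebraicClasses_one A hh hh) hh

/-- **The fact from (κ₃ + span) alone: Thm. 1.4.1 + "`κ₃` is algebraic" ⇒ Thm. 1.5.1, on the
carriers.** IF on every hyperbolic `(A, φ, h)` as in the fact there is ONE algebraic class
`κ ∈ H⁶(A(ℂ); ℂ)` (print: `κ₃(ℰ) = q^*κ₃(ℬ)` of the deformed semiregular secant sheaf, algebraic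
as a characteristic class of a twisted coherent sheaf wherever it deforms) such that every rational
`(3,3)`-class of the Weil plane lies in the `ℂ`-span of the `ℕ[φ]`-translates `(x·𝟙 + y·φ)^* κ`
and of `h³ = (h ∪ h) ∪ h` (Thm. 1.4.1: "The `η(K)`-translates of … `κ₃(ℰ)` …, together with `h³`,
span the `3`-dimensional subspace `ℚ h³ ⊕ HW_P`"), THEN the fact — the translates are algebraic by
`map_nsmul_id_add_nsmul_mem_algebraicClasses` and `h³` by
`cupProduct_cupProduct_mem_algebraicClasses_three` ∘ `symmetrisedHyperplaneClass_mem_algebraicClasses`.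
The hypothesis is the residual obligation of the printed proof on these carriers (a hypothesis of
a theorem, not a named fact). [cite: Markman2025SecantWeil, Thm. 1.4.1 and Thm. 1.5.1 (proof)] -/
theorem Markman2025_weilClasses_algebraic_hyperbolicSixfold_of_kappa₃_translates_span
    (hκ : ∀ (d : ℕ), 0 < d → ∀ (A : Motives.AbelianVariety ℂ) (φ : A ⟶ A), A.dim = 2 * 3 →
      Motives.IsSmoothProjective (2 * 3) A.X → φ ≫ φ = -(d • 𝟙 A) →
        ∀ (e : Motives.ProjectiveEmbedding A.X) (a : complexBetti (Motives.projectiveSpace e.n ℂ) 2),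
          IsRationalClass a → a ≠ 0 →
            Motives.IsHyperbolicWeilType A φ 3
              ((d : ℂ) • complexBetti.map e.ι 2 a +
                complexBetti.map φ.hom.hom.hom 2 (complexBetti.map e.ι 2 a)) →
              ∃ κ : complexBetti A.X (2 * 3), κ ∈ algebraicClasses A.X 3 ∧
                ∀ c : complexBetti A.X (2 * 3), IsRationalClass c →
                  IsOfHodgeType (2 * 3) A.X (2 * 3) 3 3 c → c ∈ weilClassesOf A φ 3 d →
                    c ∈ Submodule.span ℂ
                      ({c' | ∃ x y : ℕ,
                          c' = complexBetti.map (x • 𝟙 A + y • φ).hom.hom.hom (2 * 3) κ} ∪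
                        {cupProduct (two_mul_add_two_mul 2 1)
                          (cupProduct (two_mul_add_two_mul 1 1)
                            ((d : ℂ) • complexBetti.map e.ι 2 a +
                              complexBetti.map φ.hom.hom.hom 2 (complexBetti.map e.ι 2 a))
                            ((d : ℂ) • complexBetti.map e.ι 2 a +
                              complexBetti.map φ.hom.hom.hom 2 (complexBetti.map e.ι 2 a)))
                          ((d : ℂ) • complexBetti.map e.ι 2 a +
                            complexBetti.map φ.hom.hom.hom 2 (complexBetti.map e.ι 2 a))})) :
    Markman2025_weilClasses_algebraic_hyperbolicSixfold := by
  intro d hd A φ hA hX hφ e a ha ha0 hhyp c hc h33 hW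
  obtain ⟨κ, hκalg, hspan⟩ := hκ d hd A φ hA hX hφ e a ha ha0 hhyp
  refine (Submodule.span_le.mpr ?_) (hspan c hc h33 hW)
  rintro w (⟨x, y, rfl⟩ | hw)
  · exact map_nsmul_id_add_nsmul_mem_algebraicClasses hd hφ x y hκalg
  · rw [Set.mem_singleton_iff] at hw
    rw [hw]
    exact cupProduct_cupProduct_mem_algebraicClasses_three
      (symmetrisedHyperplaneClass_mem_algebraicClasses hd hφ e a)

/-! ### The linear algebra of "translates span": eigencomponents of classes in a stable subspace

How a spanning statement like that of Thm. 1.4.1 is obtained and used: the translates `T_p κ`,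
`p ∈ P`, of a vector `κ = Σᵢ κᵢ` whose components are joint eigenvectors of the family `(T_p)` for
pairwise distinct characters `χᵢ : P → F` span the same space as the components `κᵢ` (the
projectors onto the `χᵢ`-components are polynomials in the `T_p`). We prove the direction needed
for algebraicity, in the form: a subspace `S` stable under the `T_p` and containing `Σᵢ κᵢ`
contains every `κᵢ`. Applied with `T_p = (x·𝟙 + y·φ)^*`, `p = (x, y) ∈ ℕ² ∖ {(0,0)}`, and
`S = algebraicClasses A.X n` (stable by `map_nsmul_id_add_nsmul_mem_algebraicClasses`). -/

/-- **Joint eigencomponents of a vector in a stable subspace lie in the subspace** (pure linear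
algebra). Let `T_p` (`p ∈ P`) be linear endomorphisms of `V` preserving the subspace `S`, and let
`v_i` (`i ∈ s`, a finite set) be joint eigenvectors, `T_p v_i = χ_i(p) v_i`, for characters
`χ_i : P → F` pairwise separated on `s` (`χ_i(p) ≠ χ_j(p)` for some `p`, whenever `i ≠ j`). If
`Σ_{i ∈ s} v_i ∈ S` then every `v_i ∈ S`. Proof by strong induction on `s`: for `i ≠ j` in `s`
pick `p` with `χ_i(p) ≠ χ_j(p)`; the vectors `(χ_k(p) - χ_j(p)) v_k` are again joint eigenvectors,
their sum over `s ∖ {j}` is `T_p(Σ v) - χ_j(p) Σ v ∈ S`, so by induction `(χ_i(p) - χ_j(p)) v_i ∈ S`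
with a non-zero scalar. (The mechanism behind the linear independence of eigenvectors with
distinct eigenvalues, Mathlib's `Module.End.eigenvectors_linearIndependent`, for membership in a
stable subspace and a commuting family.) [folklore] -/
theorem mem_of_sum_eigenvectors_mem {F V P ι : Type*} [Field F] [AddCommGroup V] [Module F V]
    (T : P → V →ₗ[F] V) (S : Submodule F V) (hS : ∀ p, ∀ v ∈ S, T p v ∈ S)
    (χ : ι → P → F) (s : Finset ι)
    (hχ : ∀ i ∈ s, ∀ j ∈ s, i ≠ j → ∃ p, χ i p ≠ χ j p)
    (v : ι → V) (hv : ∀ i ∈ s, ∀ p, T p (v i) = χ i p • v i)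
    (hsum : ∑ i ∈ s, v i ∈ S) : ∀ i ∈ s, v i ∈ S := by
  classical
  induction s using Finset.strongInduction generalizing v with
  | H s ih =>
    intro i hi
    by_cases hsi : s.erase i = ∅
    · -- `s = {i}`: the sum is `v i`
      have hs : s = {i} := by
        ext k
        constructor
        · intro hk
          by_contra hki
          have : k ∈ s.erase i := Finset.mem_erase.mpr ⟨fun h => hki (by simp [h]), hk⟩
          rw [hsi] at this
          exact absurd this (Finset.notMem_empty k)
        · intro hk
          rw [Finset.mem_singleton] at hk
          rwa [hk]
      rw [hs, Finset.sum_singleton] at hsum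
      exact hsum
    · obtain ⟨j, hj⟩ := Finset.nonempty_iff_ne_empty.mpr hsi
      obtain ⟨hji, hjs⟩ := Finset.mem_erase.mp hj
      obtain ⟨p, hp⟩ := hχ i hi j hjs (Ne.symm hji)
      -- the twisted family `v' k = (χ k p - χ j p) • v k`, whose `j`-component vanishes
      set v' : ι → V := fun k => (χ k p - χ j p) • v k with hv'
      have hsum' : ∑ k ∈ s.erase j, v' k ∈ S := by
        have h1 : ∑ k ∈ s.erase j, v' k = ∑ k ∈ s, v' k := by
          rw [Finset.sum_erase]
          simp [hv']
        have h2 : ∑ k ∈ s, v' k = T p (∑ k ∈ s, v k) - χ j p • ∑ k ∈ s, v k := by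
          rw [map_sum, Finset.smul_sum, ← Finset.sum_sub_distrib]
          refine Finset.sum_congr rfl fun k hk => ?_
          rw [hv k hk p, hv']
          exact sub_smul _ _ _
        rw [h1, h2]
        exact S.sub_mem (hS p _ hsum) (S.smul_mem _ hsum)
      have hv'eig : ∀ k ∈ s.erase j, ∀ q, T q (v' k) = χ k q • v' k := by
        intro k hk q
        simp only [hv', map_smul]
        rw [hv k (Finset.mem_of_mem_erase hk) q, smul_comm]
      have hχ' : ∀ a ∈ s.erase j, ∀ b ∈ s.erase j, a ≠ b → ∃ q, χ a q ≠ χ b q :=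
        fun a ha b hb hab => hχ a (Finset.mem_of_mem_erase ha) b (Finset.mem_of_mem_erase hb) hab
      have key := ih (s.erase j) (Finset.erase_ssubset hjs) hχ' v' hv'eig hsum' i
        (Finset.mem_erase.mpr ⟨Ne.symm hji, hi⟩)
      -- `key : (χ i p - χ j p) • v i ∈ S`, with a non-zero scalar
      have hne : χ i p - χ j p ≠ 0 := sub_ne_zero.mpr hp
      have h := S.smul_mem (χ i p - χ j p)⁻¹ key
      simp only [hv', smul_smul, inv_mul_cancel₀ hne, one_smul] at h
      exact h

/-- **Eigencomponents of an algebraic class are algebraic.** For `φ ≫ φ = -d`, `d ≥ 1`: if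
`v_i ∈ pullbackEigenclasses A φ (2n) χ_i` (`i ∈ s`) for characters pairwise separated AWAY FROM
THE ORIGIN (`χ_i(x,y) ≠ χ_j(x,y)` for some `(x, y) ≠ (0, 0)`), and `Σ_{i ∈ s} v_i` is algebraic,
then every `v_i` is algebraic (`mem_of_sum_eigenvectors_mem` with `S = algebraicClasses A.X n`,
stable under the translates by `map_nsmul_id_add_nsmul_mem_algebraicClasses`). In print: the
components of the algebraic `κ(ℰ)` in the `η(K)`-isotypic summands `⋀ᵃ W ⊗ ⋀ᵇ W̄` of `H^{a+b}` are
algebraic. [cite: Markman2025SecantWeil, Thm. 1.4.1 and Thm. 1.5.1 (proof)] [cite: vanGeemen1994HodgeAV, proof of Thm. 6.12] -/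
theorem mem_algebraicClasses_of_sum_mem_pullbackEigenclasses {n d : ℕ} (hd : 0 < d) {φ : A ⟶ A}
    (hφ : φ ≫ φ = -(d • 𝟙 A)) {ι : Type*} (s : Finset ι) (χ : ι → ℕ → ℕ → ℂ)
    (hχ : ∀ i ∈ s, ∀ j ∈ s, i ≠ j → ∃ x y : ℕ, (x, y) ≠ (0, 0) ∧ χ i x y ≠ χ j x y)
    (v : ι → complexBetti A.X (2 * n))
    (hv : ∀ i ∈ s, v i ∈ pullbackEigenclasses A φ (2 * n) (χ i))
    (hsum : ∑ i ∈ s, v i ∈ algebraicClasses A.X n) : ∀ i ∈ s, v i ∈ algebraicClasses A.X n := by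
  refine mem_of_sum_eigenvectors_mem (P := {q : ℕ × ℕ // q ≠ (0, 0)})
    (fun q => (complexBetti.map (q.1.1 • 𝟙 A + q.1.2 • φ).hom.hom.hom (2 * n)).hom)
    (algebraicClasses A.X n) (fun q w hw => ?_) (fun i q => χ i q.1.1 q.1.2) s ?_ v ?_ hsum
  · exact map_nsmul_id_add_nsmul_mem_algebraicClasses hd hφ q.1.1 q.1.2 hw
  · intro i hi j hj hij
    obtain ⟨x, y, hxy, h⟩ := hχ i hi j hj hij
    exact ⟨⟨(x, y), hxy⟩, h⟩
  · intro i hi q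
    exact (mem_pullbackEigenclasses_iff.mp (hv i hi)) q.1.1 q.1.2

/-- **The two Weil characters are separated away from the origin**: for `n, d ≥ 1` there is
`x ∈ ℕ` with `(x + i√d)²ⁿ ≠ (x - i√d)²ⁿ` (test endomorphism `x·𝟙 + 1·φ`, an isogeny) —
otherwise `i√d = 0` by `eq_zero_of_forall_natCast_add_pow_eq` (the argument of
`disjoint_weilClassesPlus_weilClassesMinus`). [cite: vanGeemen1994HodgeAV, proof of Thm. 6.12] -/
theorem exists_ne_weilCharacter {n d : ℕ} (hn : 0 < n) (hd : 0 < d) :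
    ∃ x y : ℕ, (x, y) ≠ (0, 0) ∧
      ((x : ℂ) + (y : ℂ) * Complex.I * (Real.sqrt d : ℂ)) ^ (2 * n) ≠
        ((x : ℂ) - (y : ℂ) * Complex.I * (Real.sqrt d : ℂ)) ^ (2 * n) := by
  by_contra! hall
  have hsq : (Real.sqrt d : ℂ) ≠ 0 := by
    rw [Ne, Complex.ofReal_eq_zero]
    exact (Real.sqrt_pos.mpr (by exact_mod_cast hd)).ne'
  refine mul_ne_zero Complex.I_ne_zero hsq
    (eq_zero_of_forall_natCast_add_pow_eq (m := 2 * n) (by omega) fun x => ?_)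
  have h := hall x 1 (by simp)
  simpa using h

/-- **The `E₊`- and `E₋`-components of an algebraic class of the Weil plane are algebraic**
(unconditional): for `φ ≫ φ = -d`, `n, d ≥ 1`, if `c₁ ∈ E₊ = weilClassesPlus A φ n d`,
`c₂ ∈ E₋ = weilClassesMinus A φ n d` and `c₁ + c₂ ∈ algebraicClasses A.X n`, then `c₁` and `c₂`
are algebraic (two components, the Weil characters being separated at an isogeny `x·𝟙 + φ`). So
`algebraicClasses ⊓ (E₊ ⊔ E₋) = (algebraicClasses ⊓ E₊) ⊔ (algebraicClasses ⊓ E₋)`.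
[cite: Markman2025SecantWeil, Thm. 1.5.1 (proof)] [cite: vanGeemen1994HodgeAV, proof of Thm. 6.12] -/
theorem mem_algebraicClasses_of_add_mem_weilClasses {n d : ℕ} (hn : 0 < n) (hd : 0 < d)
    {φ : A ⟶ A} (hφ : φ ≫ φ = -(d • 𝟙 A)) {c₁ c₂ : complexBetti A.X (2 * n)}
    (h₁ : c₁ ∈ weilClassesPlus A φ n d) (h₂ : c₂ ∈ weilClassesMinus A φ n d)
    (halg : c₁ + c₂ ∈ algebraicClasses A.X n) :
    c₁ ∈ algebraicClasses A.X n ∧ c₂ ∈ algebraicClasses A.X n := by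
  -- index the two components by `Bool`: `true ↦ (E₊, c₁)`, `false ↦ (E₋, c₂)`
  let χ : Bool → ℕ → ℕ → ℂ := fun b x y =>
    if b then ((x : ℂ) + (y : ℂ) * Complex.I * (Real.sqrt d : ℂ)) ^ (2 * n)
    else ((x : ℂ) - (y : ℂ) * Complex.I * (Real.sqrt d : ℂ)) ^ (2 * n)
  let v : Bool → complexBetti A.X (2 * n) := fun b => if b then c₁ else c₂
  have hv : ∀ b ∈ (Finset.univ : Finset Bool), v b ∈ pullbackEigenclasses A φ (2 * n) (χ b) := by
    rintro (_ | _) -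
    · exact h₂
    · exact h₁
  have hχ : ∀ i ∈ (Finset.univ : Finset Bool), ∀ j ∈ (Finset.univ : Finset Bool), i ≠ j →
      ∃ x y : ℕ, (x, y) ≠ (0, 0) ∧ χ i x y ≠ χ j x y := by
    obtain ⟨x, y, hxy, hne⟩ := exists_ne_weilCharacter hn hd
    rintro (_ | _) - (_ | _) - hij
    · exact absurd rfl hij
    · exact ⟨x, y, hxy, hne.symm⟩
    · exact ⟨x, y, hxy, hne⟩
    · exact absurd rfl hij
  have hsum : ∑ b ∈ (Finset.univ : Finset Bool), v b ∈ algebraicClasses A.X n := by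
    simpa [v] using halg
  have key := mem_algebraicClasses_of_sum_mem_pullbackEigenclasses hd hφ Finset.univ χ hχ v hv hsum
  exact ⟨key true (Finset.mem_univ _), key false (Finset.mem_univ _)⟩

/-- **The Weil plane is algebraic as soon as `E₊` and `E₋` are the lines through the components of
one algebraic class** (how a statement like Thm. 1.4.1 yields algebraicity): for `φ ≫ φ = -d`,
`n, d ≥ 1`, `c₁ ∈ E₊`, `c₂ ∈ E₋` with `c₁ + c₂` algebraic (in print: the `⋀⁶ W`- and
`⋀⁶ W̄`-components of the algebraic `κ₃(ℰ)`, non-zero by its `K`-secant property) and `E₊ ≤ ℂ c₁`,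
`E₋ ≤ ℂ c₂` (in print: `E₊ = ⋀⁶ W`, `E₋ = ⋀⁶ W̄` are lines, van Geemen, proof of Thm. 6.12), the
whole Weil plane `E₊ ⊔ E₋` is algebraic. [cite: Markman2025SecantWeil, Thm. 1.4.1 and Thm. 1.5.1 (proof)]
[cite: vanGeemen1994HodgeAV, proof of Thm. 6.12] -/
theorem weilClassesOf_le_algebraicClasses_of_components {n d : ℕ} (hn : 0 < n) (hd : 0 < d)
    {φ : A ⟶ A} (hφ : φ ≫ φ = -(d • 𝟙 A)) {c₁ c₂ : complexBetti A.X (2 * n)}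
    (h₁ : c₁ ∈ weilClassesPlus A φ n d) (h₂ : c₂ ∈ weilClassesMinus A φ n d)
    (halg : c₁ + c₂ ∈ algebraicClasses A.X n)
    (hEp : weilClassesPlus A φ n d ≤ ℂ ∙ c₁) (hEm : weilClassesMinus A φ n d ≤ ℂ ∙ c₂) :
    weilClassesOf A φ n d ≤ algebraicClasses A.X n := by
  obtain ⟨hc₁, hc₂⟩ := mem_algebraicClasses_of_add_mem_weilClasses hn hd hφ h₁ h₂ halg
  exact sup_le (hEp.trans ((Submodule.span_singleton_le_iff_mem _ _).mpr hc₁))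
    (hEm.trans ((Submodule.span_singleton_le_iff_mem _ _).mpr hc₂))

/-- **The fact's conclusion for one `(A, φ, d)`, `n = 3`, from the components of one algebraic
class**: on a complex abelian sixfold with `φ ≫ φ = -d`, `d ≥ 1`, if an algebraic class of the Weil
plane has components `c₁ ∈ E₊`, `c₂ ∈ E₋` spanning `E₊`, `E₋` respectively, then every rational
`(3,3)`-class of `weilClassesOf A φ 3 d` is algebraic (conclusion of
`Markman2025_weilClasses_algebraic_hyperbolicSixfold` for `(A, φ, d)`).
[cite: Markman2025SecantWeil, Thm. 1.4.1 and Thm. 1.5.1 (proof)] -/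
theorem Markman2025_weilClasses_algebraic_hyperbolicSixfold.pointwise_of_components {d : ℕ}
    (hd : 0 < d) {φ : A ⟶ A} (hφ : φ ≫ φ = -(d • 𝟙 A)) {c₁ c₂ : complexBetti A.X (2 * 3)}
    (h₁ : c₁ ∈ weilClassesPlus A φ 3 d) (h₂ : c₂ ∈ weilClassesMinus A φ 3 d)
    (halg : c₁ + c₂ ∈ algebraicClasses A.X 3)
    (hEp : weilClassesPlus A φ 3 d ≤ ℂ ∙ c₁) (hEm : weilClassesMinus A φ 3 d ≤ ℂ ∙ c₂) :
    ∀ c : complexBetti A.X (2 * 3), IsRationalClass c →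
      IsOfHodgeType (2 * 3) A.X (2 * 3) 3 3 c → c ∈ weilClassesOf A φ 3 d →
        c ∈ algebraicClasses A.X 3 :=
  fun _ _ _ hcW ↦
    weilClassesOf_le_algebraicClasses_of_components (by norm_num) hd hφ h₁ h₂ halg hEp hEm hcW

/-- **The fact from (components): one algebraic class with non-zero components spanning the two
Weil lines, on every hyperbolic sixfold, ⇒ Thm. 1.5.1 on the carriers.** IF on every hyperbolic
`(A, φ, h)` as in the fact there are `c₁ ∈ E₊`, `c₂ ∈ E₋` with `c₁ + c₂` algebraic and
`E₊ ≤ ℂ c₁`, `E₋ ≤ ℂ c₂` (print: the `⋀⁶ W`- and `⋀⁶ W̄`-components of the algebraic `κ₃(ℰ)`, which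
are non-zero — this is how "the `η(K)`-translates of `κ₃(ℰ)` … span … `HW_P`" — and `E±` are
lines), THEN the fact, by `weilClassesOf_le_algebraicClasses_of_components` (the components are
algebraic by the eigencomponent lemma, and they span the Weil plane). The hypothesis is a
residual obligation of the printed proof equivalent, granted `dim E± = 1`, to (κ₃ + span); it is a
hypothesis of a theorem, not a named fact. [cite: Markman2025SecantWeil, Thm. 1.4.1 and Thm. 1.5.1 (proof)]
[cite: vanGeemen1994HodgeAV, proof of Thm. 6.12] -/
theorem Markman2025_weilClasses_algebraic_hyperbolicSixfold_of_components
    (hcomp : ∀ (d : ℕ), 0 < d → ∀ (A : Motives.AbelianVariety ℂ) (φ : A ⟶ A), A.dim = 2 * 3 →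
      Motives.IsSmoothProjective (2 * 3) A.X → φ ≫ φ = -(d • 𝟙 A) →
        ∀ (e : Motives.ProjectiveEmbedding A.X) (a : complexBetti (Motives.projectiveSpace e.n ℂ) 2),
          IsRationalClass a → a ≠ 0 →
            Motives.IsHyperbolicWeilType A φ 3
              ((d : ℂ) • complexBetti.map e.ι 2 a +
                complexBetti.map φ.hom.hom.hom 2 (complexBetti.map e.ι 2 a)) →
              ∃ c₁ c₂ : complexBetti A.X (2 * 3),
                c₁ ∈ weilClassesPlus A φ 3 d ∧ c₂ ∈ weilClassesMinus A φ 3 d ∧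
                  c₁ + c₂ ∈ algebraicClasses A.X 3 ∧
                    weilClassesPlus A φ 3 d ≤ ℂ ∙ c₁ ∧ weilClassesMinus A φ 3 d ≤ ℂ ∙ c₂) :
    Markman2025_weilClasses_algebraic_hyperbolicSixfold := by
  intro d hd A φ hA hX hφ e a ha ha0 hhyp c _ _ hW
  obtain ⟨c₁, c₂, h₁, h₂, halg, hEp, hEm⟩ := hcomp d hd A φ hA hX hφ e a ha ha0 hhyp
  exact weilClassesOf_le_algebraicClasses_of_components (by norm_num) hd hφ h₁ h₂ halg hEp hEm hW

/-! ### Hypothesis (V) of the first sibling's Cor. 1.6.1 assembly, discharged -/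

section Partner

variable (G : GysinFormalism) {A₁ A₂ : Motives.AbelianVariety ℂ}

/-- **`….fourfold_of_hyperbolic_partner` without hypothesis (V).** The first sibling's assembly
of Cor. 1.6.1 (proof) = arXiv:2509.23403 §11.5 Step 2 (granted the fact: the Weil classes of a
complex abelian fourfold `(A₁, φ₁)` with a surface partner `(A₂, φ₂)` making the product sixfold
hyperbolic are algebraic, given Schoen's inputs) assumed (V) "cup products of algebraic classes
of codimensions `3` and `1` on `A₁ × A₂` are algebraic" (Voisin II Prop. 9.20 in bidegree
`(6, 2)`). On the abelian variety `A₁ × A₂` this is the tree's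
`AbelianVariety.cupProduct_mem_algebraicClasses_one` (cycles move by a general translate), so (V)
is dropped; the remaining hypotheses are verbatim those of the sibling.
[cite: Markman2025SecantWeil, Cor. 1.6.1 (proof)] [cite: Markman2025SurveySecant, §11.5 Step 2]
[cite: VoisinHodgeII2003, §9.2.4 Prop. 9.20] [cite: Schoen1998HodgeWeilAddendum, §10 (Proposition and proof, pp. 332–333)] -/
theorem Markman2025_weilClasses_algebraic_hyperbolicSixfold.fourfold_of_hyperbolic_partner'
    (h : Markman2025_weilClasses_algebraic_hyperbolicSixfold) {d : ℕ} (hd : 0 < d)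
    {φ₁ : A₁ ⟶ A₁} {φ₂ : A₂ ⟶ A₂} {Φ : A₁.prod A₂ ⟶ A₁.prod A₂}
    (hA₁d : A₁.dim = 2 * 2) (hA₂d : A₂.dim = 2 * 1)
    (hA₁ : Motives.IsSmoothProjective (2 * 2) A₁.X) (hA₂ : Motives.IsSmoothProjective (2 * 1) A₂.X)
    (h₁ : Φ ≫ Motives.AbelianVariety.fst A₁ A₂ = Motives.AbelianVariety.fst A₁ A₂ ≫ φ₁)
    (h₂ : Φ ≫ Motives.AbelianVariety.snd A₁ A₂ = Motives.AbelianVariety.snd A₁ A₂ ≫ φ₂)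
    (hΦ : Φ ≫ Φ = -(d • 𝟙 (A₁.prod A₂))) (e : Motives.ProjectiveEmbedding (A₁.prod A₂).X)
    {a : complexBetti (Motives.projectiveSpace e.n ℂ) 2} (ha : IsRationalClass a) (ha0 : a ≠ 0)
    (hhyp : Motives.IsHyperbolicWeilType (A₁.prod A₂) Φ 3
      ((d : ℂ) • complexBetti.map e.ι 2 a +
        complexBetti.map Φ.hom.hom.hom 2 (complexBetti.map e.ι 2 a)))
    (hfst : PreservesHodgeType (2 * 3) (2 * 2) (Motives.AbelianVariety.fst A₁ A₂).hom.hom.hom)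
    (hsnd : PreservesHodgeType (2 * 3) (2 * 1) (Motives.AbelianVariety.snd A₁ A₂).hom.hom.hom)
    (hcupH : CupPreservesHodgeType (2 * 3) (A₁.prod A₂).X)
    {up um η : complexBetti A₂.X (2 * 1)} (hup : up ∈ weilClassesPlus A₂ φ₂ 1 d)
    (hum : um ∈ weilClassesMinus A₂ φ₂ 1 d) (hr₂ : IsRationalClass (up + um))
    (hw₂ : IsOfHodgeType (2 * 1) A₂.X (2 * 1) 1 1 (up + um)) (hη : η ∈ algebraicClasses A₂.X 1)
    (hnep : G.gysin (isSmoothProjective_prod hA₁ hA₂) hA₁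
        (Motives.AbelianVariety.fst A₁ A₂).hom.hom.hom
        (show 2 * (2 * 1) + 2 * (2 * 2) = 0 + 2 * (2 * 2 + 2 * 1) by omega)
        (complexBetti.map (Motives.AbelianVariety.snd A₁ A₂).hom.hom.hom (2 * (2 * 1))
          (cupProduct (show 2 * 1 + 2 * 1 = 2 * (2 * 1) by omega) up η)) ≠ 0)
    (hnem : G.gysin (isSmoothProjective_prod hA₁ hA₂) hA₁
        (Motives.AbelianVariety.fst A₁ A₂).hom.hom.hom
        (show 2 * (2 * 1) + 2 * (2 * 2) = 0 + 2 * (2 * 2 + 2 * 1) by omega)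
        (complexBetti.map (Motives.AbelianVariety.snd A₁ A₂).hom.hom.hom (2 * (2 * 1))
          (cupProduct (show 2 * 1 + 2 * 1 = 2 * (2 * 1) by omega) um η)) ≠ 0) :
    ∀ c : complexBetti A₁.X (2 * 2), IsRationalClass c →
      IsOfHodgeType (2 * 2) A₁.X (2 * 2) 2 2 c → c ∈ weilClassesOf A₁ φ₁ 2 d →
        c ∈ algebraicClasses A₁.X 2 :=
  have hdim : (A₁.prod A₂).dim = 2 * 3 := by
    have h6 := dim_prod_eq_two_mul hA₁d hA₂d
    omega
  Markman2025_weilClasses_algebraic_abelianFourfold.pointwise_of_sixfold_partner G hd hA₁ hA₂ h₁ h₂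
    (h d hd (A₁.prod A₂) Φ hdim (isSmoothProjective_prod_two_mul hA₁ hA₂) hΦ e a ha ha0 hhyp)
    (fun _ _ hx hb ↦ AbelianVariety.cupProduct_mem_algebraicClasses_one (A₁.prod A₂) hx hb)
    hfst hsnd hcupH hup hum hr₂ hw₂ hη hnep hnem

end Partner

end HodgeTheory

/-! ### Granted `H•(A(ℂ)) = ⋀• H¹`: one non-zero algebraic Weil class suffices -/

section OneWeilClass

variable {A : Motives.AbelianVariety ℂ}

/-- **One non-zero algebraic Weil class makes the whole Weil plane algebraic**, granted
`H•(A(ℂ); ℂ) = ⋀• H¹` and `b₁ = 4n` (for `φ ≫ φ = -d`, `d ≥ 1`, `n ≥ 1`): write the class as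
`c₊ + c₋` along `W_K = E₊ ⊕ E₋`; both components are algebraic (the algebraic classes are stable
under the `(x·𝟙 + y·φ)^*`, `mem_algebraicClasses_of_add_mem_weilClasses`); one of them is non-zero
and spans its line (`dim E± = 1`), and the complex conjugate of that component is a non-zero
algebraic class on the other line. [cite: vanGeemen1994HodgeAV, proof of Thm. 6.12]
[cite: Markman2025SecantWeil, Thm. 1.5.1 (proof, §9)] -/
theorem weilClassesOf_le_algebraicClasses_of_exists_ne_zero {n d : ℕ} (hn : 0 < n) (hd : 0 < d)
    {φ : A ⟶ A} (hφ : φ ≫ φ = -(d • 𝟙 A))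
    (hΛ : HasExteriorCohomologyH1 ℂ (Motives.ComplexPoints A.X))
    (hb₁ : Module.finrank ℂ (complexBetti A.X 1) = 2 * (2 * n))
    (hex : ∃ c ∈ weilClassesOf A φ n d, c ∈ algebraicClasses A.X n ∧ c ≠ 0) :
    weilClassesOf A φ n d ≤ algebraicClasses A.X n := by
  obtain ⟨c, hcW, hca, hc0⟩ := hex
  obtain ⟨c₁, h₁, c₂, h₂, rfl⟩ := Submodule.mem_sup.mp hcW
  obtain ⟨ha₁, ha₂⟩ := mem_algebraicClasses_of_add_mem_weilClasses hn hd hφ h₁ h₂ hca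
  -- a non-zero algebraic class on EACH line
  have hplus : ∃ c ∈ weilClassesPlus A φ n d, c ∈ algebraicClasses A.X n ∧ c ≠ 0 := by
    by_cases h10 : c₁ = 0
    · have h20 : c₂ ≠ 0 := by rintro rfl; exact hc0 (by rw [h10, add_zero])
      exact exists_mem_weilClassesPlus_mem_algebraicClasses ⟨c₂, h₂, ha₂, h20⟩
    · exact ⟨c₁, h₁, ha₁, h10⟩
  have hminus : ∃ c ∈ weilClassesMinus A φ n d, c ∈ algebraicClasses A.X n ∧ c ≠ 0 :=
    exists_mem_weilClassesMinus_mem_algebraicClasses hplus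
  obtain ⟨e₁, he₁, hae₁, he₁0⟩ := hplus
  obtain ⟨e₂, he₂, hae₂, he₂0⟩ := hminus
  exact sup_le
    ((weilClassesPlus_le_span_singleton hΛ hb₁ hd hφ he₁ he₁0).trans
      ((Submodule.span_singleton_le_iff_mem _ _).mpr hae₁))
    ((weilClassesMinus_le_span_singleton hΛ hb₁ hd hφ he₂ he₂0).trans
      ((Submodule.span_singleton_le_iff_mem _ _).mpr hae₂))

/-- Conversely (trivially), if the Weil plane is algebraic it contains a non-zero algebraic class
(it is a plane, `finrank_weilClassesOf_eq_two`). [cite: vanGeemen1994HodgeAV, 4.9] -/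
theorem exists_ne_zero_of_weilClassesOf_le_algebraicClasses {n d : ℕ} (hn : 0 < n) (hd : 0 < d)
    {φ : A ⟶ A} (hφ : φ ≫ φ = -(d • 𝟙 A))
    (hΛ : HasExteriorCohomologyH1 ℂ (Motives.ComplexPoints A.X))
    (hb₁ : Module.finrank ℂ (complexBetti A.X 1) = 2 * (2 * n))
    (hW : weilClassesOf A φ n d ≤ algebraicClasses A.X n) :
    ∃ c ∈ weilClassesOf A φ n d, c ∈ algebraicClasses A.X n ∧ c ≠ 0 := by
  have h2 := finrank_weilClassesOf_eq_two hΛ hb₁ hn hd hφ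
  haveI : FiniteDimensional ℂ (weilClassesOf A φ n d) := Module.finite_of_finrank_eq_succ h2
  have hnt : (weilClassesOf A φ n d) ≠ ⊥ := by
    intro h
    rw [h, finrank_bot] at h2
    exact absurd h2 (by norm_num)
  obtain ⟨c, hc, hc0⟩ := (Submodule.ne_bot_iff _).mp hnt
  exact ⟨c, hc, hW hc, hc0⟩

/-- **Granted `H•(A(ℂ)) = ⋀• H¹` and `b₁ = 4n`: the Weil plane is algebraic iff it contains a
non-zero algebraic class.** [cite: vanGeemen1994HodgeAV, proof of Thm. 6.12] -/
theorem weilClassesOf_le_algebraicClasses_iff_exists_ne_zero {n d : ℕ} (hn : 0 < n) (hd : 0 < d)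
    {φ : A ⟶ A} (hφ : φ ≫ φ = -(d • 𝟙 A))
    (hΛ : HasExteriorCohomologyH1 ℂ (Motives.ComplexPoints A.X))
    (hb₁ : Module.finrank ℂ (complexBetti A.X 1) = 2 * (2 * n)) :
    weilClassesOf A φ n d ≤ algebraicClasses A.X n ↔
      ∃ c ∈ weilClassesOf A φ n d, c ∈ algebraicClasses A.X n ∧ c ≠ 0 :=
  ⟨exists_ne_zero_of_weilClassesOf_le_algebraicClasses hn hd hφ hΛ hb₁,
    weilClassesOf_le_algebraicClasses_of_exists_ne_zero hn hd hφ hΛ hb₁⟩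

/-- **The fact's conclusion for one `(A, φ, d)`, `n = 3`, from one non-zero algebraic Weil class**,
granted `H•(A(ℂ)) = ⋀• H¹(A(ℂ))` and `b₁(A) = 12`. [cite: Markman2025SecantWeil, Thm. 1.5.1 (proof, §9)] -/
theorem Markman2025_weilClasses_algebraic_hyperbolicSixfold.pointwise_of_exists_ne_zero {d : ℕ}
    (hd : 0 < d) {φ : A ⟶ A} (hφ : φ ≫ φ = -(d • 𝟙 A))
    (hΛ : HasExteriorCohomologyH1 ℂ (Motives.ComplexPoints A.X))
    (hb₁ : Module.finrank ℂ (complexBetti A.X 1) = 2 * (2 * 3))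
    (hex : ∃ c ∈ weilClassesOf A φ 3 d, c ∈ algebraicClasses A.X 3 ∧ c ≠ 0) :
    ∀ c : complexBetti A.X (2 * 3), IsRationalClass c →
      IsOfHodgeType (2 * 3) A.X (2 * 3) 3 3 c → c ∈ weilClassesOf A φ 3 d →
        c ∈ algebraicClasses A.X 3 :=
  fun _ _ _ hcW ↦
    weilClassesOf_le_algebraicClasses_of_exists_ne_zero (by norm_num) hd hφ hΛ hb₁ hex hcW

/-- **Thm. 1.5.1 on the carriers, granted `H•(A(ℂ)) = ⋀• H¹(A(ℂ))`, from ONE non-zero algebraic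
Weil class per hyperbolic sixfold.** IF `Motives.abelianVarietyCohomologyExteriorH1` (the named
fact: `wedgeToCup : ⋀ᵏ H¹(A(ℂ); ℂ) ≅ Hᵏ(A(ℂ); ℂ)` and `b₁ = 2 dim A`) and IF every complex abelian
sixfold `A` with `φ ≫ φ = -d` (`d ≥ 1`) of hyperbolic Weil type (some symmetrised hyperplane class
`h` with `(A, η, h)`, `η = φ_ℚ/√d`, in `𝒜⁶_{K, j, d, h, or}`, i.e. `Q_h ≅ U_K³`) carries a non-zero
ALGEBRAIC class in its Weil plane `W_K ⊗ ℂ = weilClassesOf A φ 3 d` — in print: the projection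
`κ₃(B)_{W}` of Markman's class `κ(ℰ)` of the secant² object, non-zero by Thm. 1.4.1 (4)
("`κ₃(ℰ)` does not belong to [the codimension-`2` subspace `R_{3,(d)}`]") and algebraic by
Thm. 1.4.1 (3) + semiregularity (§6–§9) — THEN the named fact
`Markman2025_weilClasses_algebraic_hyperbolicSixfold` holds. The first hypothesis `hΛ` is the
instance `dim A = 6` of the named fact `Motives.abelianVarietyCohomologyExteriorH1` (its
`.hasExteriorCohomologyH1 A` and `.finrank_one A`), spelled out so that this file stays below
`Motives/AbelianVarietyCohomologyExteriorH1` in the import order; the residual hypothesis `hex`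
is exactly the content of Markman's paper not carried by the tree (secant sheaves, Orlov's
equivalence, `Spin(V)`-invariance, semiregular deformation, the period space of Weil-type
sixfolds). [cite: Markman2025SecantWeil, Thm. 1.4.1 (3)–(4) and Thm. 1.5.1 (§1.4–§1.5, proof §9)] -/
theorem Markman2025_weilClasses_algebraic_hyperbolicSixfold_of_exists_algebraic_weilClass
    (hΛ : ∀ A : Motives.AbelianVariety ℂ, A.dim = 2 * 3 →
      HasExteriorCohomologyH1 ℂ (Motives.ComplexPoints A.X) ∧
        Module.finrank ℂ (complexBetti A.X 1) = 2 * (2 * 3))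
    (hex : ∀ (d : ℕ), 0 < d → ∀ (A : Motives.AbelianVariety ℂ) (φ : A ⟶ A), A.dim = 2 * 3 →
      Motives.IsSmoothProjective (2 * 3) A.X → φ ≫ φ = -(d • 𝟙 A) →
        ∀ (e : Motives.ProjectiveEmbedding A.X) (a : complexBetti (Motives.projectiveSpace e.n ℂ) 2),
          IsRationalClass a → a ≠ 0 →
            Motives.IsHyperbolicWeilType A φ 3
              ((d : ℂ) • complexBetti.map e.ι 2 a +
                complexBetti.map φ.hom.hom.hom 2 (complexBetti.map e.ι 2 a)) →
              ∃ c ∈ weilClassesOf A φ 3 d, c ∈ algebraicClasses A.X 3 ∧ c ≠ 0) :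
    Markman2025_weilClasses_algebraic_hyperbolicSixfold := by
  intro d hd A φ hA hX hφ e a ha ha0 hhyp c _ _ hcW
  exact weilClassesOf_le_algebraicClasses_of_exists_ne_zero (by norm_num) hd hφ
    (hΛ A hA).1 (hΛ A hA).2 (hex d hd A φ hA hX hφ e a ha ha0 hhyp) hcW

end OneWeilClass

section NamedFact

/-! ### (v5) Consuming the named fact `Motives.abelianVarietyCohomologyExteriorH1` by name

The per-`A` hypotheses `hΛ : HasExteriorCohomologyH1 ℂ A(ℂ)` and `hb₁ : b₁(A) = 4n` of § (v4) (and of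
the Weil lines of `AbelianVarietyEndomorphismsHOne`) are the instance `dim A = 2n` of the named fact
`Motives.abelianVarietyCohomologyExteriorH1` (`H•(A(ℂ); ℂ) = ⋀• H¹(A(ℂ); ℂ)` by iterated cup product and
`b₁ = 2 dim A`; Lange–Birkenhake Lemma 1.1.17, Ex. 1.1.6 (7)–(8)). The theorems below take that fact
as the explicit hypothesis `h` — a CONDITIONAL use whose trust base is the named fact; nothing here
discharges it — so that, once `Motives.abelianVarietyCohomologyExteriorH1` is proved, feeding its
`…_holds` leaves Thm. 1.5.1 on the carriers reduced to exactly ONE non-zero algebraic Weil class per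
hyperbolic Weil-type sixfold (Markman's Thm. 1.4.1 (3)–(4) with §6–§9, the paper proper). -/

variable {A : Motives.AbelianVariety ℂ}

/-- The instance `dim A = 2n` of the named fact: `H•(A(ℂ)) = ⋀• H¹(A(ℂ))` and `b₁(A) = 4n`.
[cite: LangeBirkenhake1992, Lemma 1.1.17 and Exercise 1.1.6 (7)–(8)] -/
theorem hasExteriorCohomologyH1_and_finrank_one_of_dim_eq
    (h : Motives.abelianVarietyCohomologyExteriorH1) {n : ℕ} (hA : A.dim = 2 * n) :
    HasExteriorCohomologyH1 ℂ (Motives.ComplexPoints A.X) ∧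
      Module.finrank ℂ (complexBetti A.X 1) = 2 * (2 * n) :=
  ⟨h.hasExteriorCohomologyH1 A, by rw [h.finrank_one A, hA]⟩

/-- **The Weil plane is a plane**: for a complex abelian `2n`-fold `A` (`n ≥ 1`) with `φ ≫ φ = -d`
(`d ≥ 1`), `dim_ℂ (W_K ⊗ ℂ) = dim_ℂ (E₊ ⊕ E₋) = 2`, granted the named fact
`Motives.abelianVarietyCohomologyExteriorH1` (van Geemen: "the space of Weil-Hodge cycles
`W_K ⊆ B^n(X)` is ... `≅ ⋀²ⁿ_K H¹(X, ℚ)`", a `K`-line, with `⋀²ⁿ_ℂ = ⋀²ⁿ W ⊕ ⋀²ⁿ W̄ ⊕ ⋯`).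
[cite: vanGeemen1994HodgeAV, 4.8–4.9 and Lemma 5.2] -/
theorem finrank_weilClassesOf_eq_two_of_dim_eq (h : Motives.abelianVarietyCohomologyExteriorH1)
    {n d : ℕ} (hA : A.dim = 2 * n) (hn : 0 < n) (hd : 0 < d) {φ : A ⟶ A}
    (hφ : φ ≫ φ = -(d • 𝟙 A)) :
    Module.finrank ℂ (weilClassesOf A φ n d) = 2 :=
  finrank_weilClassesOf_eq_two (h.hasExteriorCohomologyH1 A) (by rw [h.finrank_one A, hA]) hn hd hφ

/-- **Granted the named fact `Motives.abelianVarietyCohomologyExteriorH1`: on a complex abelian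
`2n`-fold with `φ ≫ φ = -d` (`n, d ≥ 1`) the Weil plane is algebraic iff it contains ONE non-zero
algebraic class** (§ (v4) `weilClassesOf_le_algebraicClasses_iff_exists_ne_zero` with its per-`A`
hypotheses supplied by the named fact). [cite: vanGeemen1994HodgeAV, proof of Thm. 6.12]
[cite: Markman2025SecantWeil, Thm. 1.5.1 (proof, §9)] -/
theorem weilClassesOf_le_algebraicClasses_iff_exists_ne_zero_of_dim_eq
    (h : Motives.abelianVarietyCohomologyExteriorH1) {n d : ℕ} (hA : A.dim = 2 * n) (hn : 0 < n)
    (hd : 0 < d) {φ : A ⟶ A} (hφ : φ ≫ φ = -(d • 𝟙 A)) :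
    weilClassesOf A φ n d ≤ algebraicClasses A.X n ↔
      ∃ c ∈ weilClassesOf A φ n d, c ∈ algebraicClasses A.X n ∧ c ≠ 0 :=
  weilClassesOf_le_algebraicClasses_iff_exists_ne_zero hn hd hφ (h.hasExteriorCohomologyH1 A)
    (by rw [h.finrank_one A, hA])

/-- **Thm. 1.5.1 on the carriers from the named fact `Motives.abelianVarietyCohomologyExteriorH1` and
ONE non-zero algebraic Weil class per hyperbolic sixfold.** IF `H•(A(ℂ); ℂ) = ⋀• H¹(A(ℂ); ℂ)` with
`b₁ = 2 dim A` for complex abelian varieties (the named fact, hypothesis `h`) and IF every complex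
abelian sixfold `A` with `φ ≫ φ = -d` (`d ≥ 1`) of hyperbolic Weil type carries a non-zero ALGEBRAIC
class in its Weil plane `weilClassesOf A φ 3 d` — in print the projection of Markman's `κ(ℰ)` to the
Weil plane, non-zero by Thm. 1.4.1 (4) and algebraic on the whole `9`-dimensional component by
Thm. 1.4.1 (3), semiregularity (§6–§9) and the algebraicity locus — THEN
`Markman2025_weilClasses_algebraic_hyperbolicSixfold` holds
(`…_of_exists_algebraic_weilClass` with `hΛ` supplied by `h`).
[cite: Markman2025SecantWeil, Thm. 1.4.1 (3)–(4) and Thm. 1.5.1 (§1.4–§1.5, proof §9)]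
[cite: LangeBirkenhake1992, Lemma 1.1.17 and Exercise 1.1.6 (7)–(8)] -/
theorem Markman2025_weilClasses_algebraic_hyperbolicSixfold_of_abelianVarietyCohomologyExteriorH1
    (h : Motives.abelianVarietyCohomologyExteriorH1)
    (hex : ∀ (d : ℕ), 0 < d → ∀ (A : Motives.AbelianVariety ℂ) (φ : A ⟶ A), A.dim = 2 * 3 →
      Motives.IsSmoothProjective (2 * 3) A.X → φ ≫ φ = -(d • 𝟙 A) →
        ∀ (e : Motives.ProjectiveEmbedding A.X) (a : complexBetti (Motives.projectiveSpace e.n ℂ) 2),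
          IsRationalClass a → a ≠ 0 →
            Motives.IsHyperbolicWeilType A φ 3
              ((d : ℂ) • complexBetti.map e.ι 2 a +
                complexBetti.map φ.hom.hom.hom 2 (complexBetti.map e.ι 2 a)) →
              ∃ c ∈ weilClassesOf A φ 3 d, c ∈ algebraicClasses A.X 3 ∧ c ≠ 0) :
    Markman2025_weilClasses_algebraic_hyperbolicSixfold :=
  Markman2025_weilClasses_algebraic_hyperbolicSixfold_of_exists_algebraic_weilClass
    (fun _ hA ↦ hasExteriorCohomologyH1_and_finrank_one_of_dim_eq h hA) hex

end NamedFact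

end Literature.AlgebraicGeometry.HodgeTheory

end
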